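import Summits.QuantumFields.BalabanUV.T4Continuum.Spine.NE1p.DressedStabilityOfCanonicalRStepSliceWinSchedules
import Summits.QuantumFields.BalabanUV.T4Continuum.Spine.NE1p.DressedStabilityStrictOfCanonicalSliceWinSchedules

/-!
# T⁴ programme, spine estimate NE1′ (node O3b/H2) — THE ABSORPTION-ROUTE FACE: the canonical terminal face through the ℝ-step seam
# with (w2-act)'s `hB` ∕ `hE` asked at SPECTATOR steps ONLY, every other step carried FROZEN by the identity inside the H2 step law
# (swarm row «S3t» of `t4/formal/NE1p/LEAVES.md`; INTENT HOME/CLAIMS.log l.12747, owner GO l.12758, BOOKED typer R-T71 (ii) l.12828)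

Cell `pub-balaban`, sub-cell `t4`, BINDER-OWNERS row NE1′ (owner lineage t4-ne1p-p1; ROOT-C OF RECORD `DressedRootStrict.DressedStabilityStrict`
p216910, ROOT-B `DressedRootFam.DressedBudget` p211697, headline `DressedRoot.DressedStability` p211416); formalisation crew
`b2b-balaban-t4-ne1p-formalise-*`, seat `…-leaf-04` (gen 6).  ADDITIVE — imports leaf-02's S3l.1 `Spine/NE1p/DressedStabilityOfCanonicalRStepSliceWinSchedules`
(p215263: S3l's telescope over the canonical data, L-B read off the ℝ-step `Rs a K` — S5e `hbirth_of_rstep_cell`, S5 §3 `hbirth_of_rstep`, the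
anchoring count — BY NAME) and leaf-08's S3s-1 `Spine/NE1p/DressedStabilityStrictOfCanonicalSliceWinSchedules` (p217391: the bridge
`dressedStabilityStrict_of_cellWith` to the root of record) ONLY; modifies nothing.  STATUS UNDER T4-DAG v28 §8 Q40 (Q-NE1p-route RULED
F-2-ROUTE-FULL; typer R-T71 (i)): leaf T's END of record is the deterministic `T4TrajectoryComparison.transportsFromVar_of_response` (owner face
N0e `DressedRootComposition` p217849); EVERY `wOp`-layer face — S3l, S3l.1 and THIS file — is the ADMISSIBLE ALTERNATIVE (α′) BY NAME.  This
file is the (α′) layer's met ∕ frozen REDUCTION; under the pre-ruled fallback to F-2-ROUTE (γ-met) it is that route's face as offered.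

THE DICTIONARY (owner g24 `OWNER-ANSWERS-g24.md` §3 RULING F-2-ROUTE, kernel arithmetic `DressedSigmaRoute` p217353; a READING of
[Balaban1989LargeFieldII] pp. 388–391, nothing asserted): at an ℝ-step a live family inside a FIRST-class met component is ABSORBED (its
generations end; its mass re-enters through the births door — here the ℝ-step seam `Rs a K` ∕ `hlaw` of S3l.1), inside a SECOND-class
component it is FROZEN (carried un-performed, identity step, margin `s = 0`) until renewal; the normalised operation `wOp` with its (w2-act)
binders `hB : RealBaseAt …` ∕ `hE : ExponentSliceAt …` is asked ONLY at SPECTATOR steps.  `Spec a K b k` (spectator steps) is instantiation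
DATA; its complement the BOOKING splits into absorbed families (`(Rs a K).absorbs`) and frozen ones.

THE TYPING POINT (row S3t: «identity steps do not contract — how is a frozen stretch reconciled with `twoRate A₀ ρ₁ τ`?»; answer of record
R-T71 (ii), owner l.12758, leaf-05-g2 l.12783 concurring in `transportsFromVar_of_moduli_dep`'s `hcont`).  Nothing to reconcile: the per-step
class factor is the TRANSPORT RATE `ρ k = ψ·alphaCell κ` of `Trajectory.TransportsFromVar` (`lin b k′ k ≤ C·∏ρ·gen b k′`) plus regeneration,
and `ψ = L⁻²` is (I4′)'s transverse-DEFECT rate (`hrate : defect b k′ k ≤ c_δ·(L²)⁻¹^(k−k′)`) entering through the Cauchy estimate on the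
birth chart (`transportsFromVar_of_response`); the carried function's sup never contracts (it grows by `e^{3(s+s1)} ≤ alphaCell κ` per `wOp`
step, S2i `aszRec_succ`).  The booked size is the RESPONSE to scale-`k` defect pairs (`hsup`), which shrink whether or not the function
moved; an identity step meets the same slice law (sup factor `1 ≤ alphaCell κ`, same shrinking windows) with the SAME constants — no
re-booking at renewal ((α) void), no charge on `A₀` ((β) void).  IN KERNEL the frozen step is S3l's displayed H2 step law `hFn` under the
DEGENERATE DICTIONARY `(μ, base, 𝒜) := (Measure.dirac 0, 1, 0)`, `z₀ = 0`, `0 ≤ s`: then `wOp … U h = h 0`, i.e. `Fn b k′ (k+1) = Fn b k′ k`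
(§1 `wOp_dirac_of_aestronglyMeasurable`, `frozen_step_identity` — from the DISPLAYED `h𝒢`, no instance binder), and AT THAT DICTIONARY `hB`
and `hE` HOLD (§1 `realBaseAt_frozen`, `exponentSliceAt_frozen`) — so S3l.1 applies BY NAME.  (Contrast the F3-NULL twin
`T4TrajectoryDensityGatedNull`: on a null window `wOp` is evaluation too, but `RealBaseAt` FAILS there.)

CONTENTS.  §1 [folklore] the frozen-step lemmas named above (+ `wOp_dirac`, `aestronglyMeasurable_dirac` ∕ `mem_bddClass_dirac`: the
measurable-singletons one-liners).  §2 the tower-level binders ONCE = S3l.1 §1 (l.98–203 there) VERBATIM except (w2-act): `hB` ∕ `hE`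
REPLACED by `Spec` + `hBspec` ∕ `hEspec` (S3l's shapes with the extra premise `Spec a K b k`), the dictionary `hfrz` (in the theorem
headers) at `¬ Spec a K b k`; `realBaseAt_of_route` ∕ `exponentSliceAt_of_route` rebuild S3l.1's `hB` ∕ `hE` by cases.  §3 the four ENDs:
With-form (constants `(A₀, rhoOne L⁻² (4c_δ∕r) c̄ κ, L⁻³)` UNCHANGED), `DressedStability 𝒯`, ROOT-B `DressedBudget 𝒯 wt` (S3l.1's three
theorems BY NAME, its header binders `hQ` ∕ `hSg` ∕ `hcm` ∕ `hδfwk` ∕ `hvN₀` ∕ `hA` ∕ `hfan` ∕ `hamp` in the same order) and ROOT-C OF RECORD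
`DressedStabilityStrict 𝒯 (L ^ 4)` (S3s-1 `dressedStabilityStrict_of_cellWith`; Λ = L⁴ named, R-T66 (ii)).  BINDER DIFF vs S3l.1
(mechanical): −{`hB`, `hE`} +{`Spec`, `hBspec`, `hEspec`, `hfrz`}; NO instance binder added; everything else VERBATIM; conclusions literal.

OWED AT IDLE (non-spectator) STEPS — how the binders kept VERBATIM read there under `μ = dirac 0` (leaf-05-g2 (b2), R-T71 (ii)(e); listed
so that no (w2-act) content is hidden): `hFn` demands `Fn b k′ (k+1) = Fn b k′ k` of the instantiation's actual functions (true exactly where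
Bałaban's term is carried un-performed, (1.102) p. 390, or is the ghost of an absorbed family whose booked sizes the instantiation sets,
e.g. `0 ≤ Σ lin`); `h𝒢` ∕ `hmeas` = a.e.-strong measurability w.r.t. `dirac 0` (trivial under measurable singletons, §1); `hDμ` = «`0 ∈
bondBall d (W.σ k)` dirac-a.e.», `hz₁` with `z₁ = 0`; `hQ` ∕ `hSg` ∕ `hpairx` ∕ `hδf` ∕ `hδfwk` with `Sg k b = ∅`, `c b k = 0` (else `hpairx`
asks `RelGauge … (·+z₁) (·+0) (δf)`); `hs₀` with `0 ≤ s ≤ s̄⁰`.  The contraction of a frozen family's booked size is carried by (I4′)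
`hrate` ∕ `hsup` + the schedule's window nesting AT IDLE STEPS — displayed, not hidden.

HONEST FRAMING.  A kernel REDUCTION over hypothesis shapes ([folklore]; 0 sorry; 0 citations used as facts; no `def`, NO `def … : Prop`;
no estimate, no new analytic content).  Headline (c4): «NE1′'s (α′) face ⇐ the named binders with (w2-act) asked at spectator steps only»
= ⇐ EXACTLY the displayed WALL binders ∀ (a,K): (w1) `hsl`, (w2-act) `hBspec` ∕ `hEspec` ∕ `hs₀` AT SPECTATOR STEPS (printed TYPE
[Balaban1989LargeFieldII] (1.65) p. 375, (1.71)–(1.75) pp. 379–380; THE NUMBER `s̄⁰` stays a binder), (w5) `hreg` ∕ `hpre`, (I4′) `hδf` ∕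
`hδfwk` ∕ `hpairx` ∕ `hdefwk` ∕ `hrate` + `hcm` (F-6's rate `ψ = L⁻²`, caveat k3), the H2 dictionary `hFn` ∕ `h𝒢` ∕ `hQ` ∕ `hSg` ∕ `hmeas`, the
classification `Spec` ∕ `hfrz`, anchoring ∕ ℝ-step ∕ booking-convention DATA, located largeness, ratio-bounded schedules — NOT «NE1′
proved», NOT printed; 0 binders instantiated on Bałaban's densities; `FlowStep.BetaPertH` ∕ (B) ∕ G-an2-4 enter nowhere; spine PROVED
0∕9.  Rung (B)+1 on ONE finite four-torus — NOT infinite volume, NOT a mass gap, NOT OS on ℝ⁴, NOT the Clay problem.  HONEST DEPENDENCY: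
continuum YM on T⁴ ⇐ BetaPertH ∧ nine spine estimates (0/9 proved); BetaPertH ⇐ (D1) ∧ (D4) ∧ CAP+tail; G-an2-4 gates asym, D1 and NE2/3/4.
-/

noncomputable section

namespace Summit.QuantumFields.BalabanUV.T4Continuum.NE1p.DressedStabilityOfAbsorptionRouteSchedules

open MeasureTheory Set Metric Finset
open scoped BigOperators
open Literature.MathematicalPhysics.QuantumFieldTheory.Balaban1983to89
open Literature.MathematicalPhysics.QuantumFieldTheory.Balaban1983to89.T4TermFormat
open Literature.MathematicalPhysics.QuantumFieldTheory.Balaban1983to89.T4FeltGeometry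
open Literature.MathematicalPhysics.QuantumFieldTheory.Balaban1983to89.T4GatedBooking
open Literature.MathematicalPhysics.QuantumFieldTheory.Balaban1983to89.T4TrajectoryComparison
open Literature.MathematicalPhysics.QuantumFieldTheory.Balaban1983to89.T4TrajectoryModulus
open Literature.MathematicalPhysics.QuantumFieldTheory.Balaban1983to89.T4PreservedUnderR (RStep)
open T4BirthChartTransport (GaugeInvariant BirthSlice RelGauge)
open T4BlockTransport (Fld NDir latMove latN)
open T4TrajectoryDensity
open Summit.QuantumFields.BalabanUV.T4Continuum.T4TrajectoryDensityDressed
open Summit.QuantumFields.BalabanUV.T4Continuum.NE1p.DressedRoot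
open Summit.QuantumFields.BalabanUV.T4Continuum.NE1p.DressedWindowScheduleWin
open Summit.QuantumFields.BalabanUV.T4Continuum.NE1p.DressedWindowScheduleModWin
open Summit.QuantumFields.BalabanUV.T4Continuum.NE1p.DressedUniformConstants
open Summit.QuantumFields.BalabanUV.T4Continuum.NE1p.DressedTransportAssembledModData
open Summit.QuantumFields.BalabanUV.T4Continuum.NE1p.DressedAbsorptionWindow
open Summit.QuantumFields.BalabanUV.T4Continuum.NE1p.DressedBirthRStepAnchored
open Summit.QuantumFields.BalabanUV.T4Continuum.NE1p.DressedStabilityOfCanonicalRStepSliceWinSchedules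
open Summit.QuantumFields.BalabanUV.T4Continuum.NE1p.DressedStabilityStrictOfCanonicalSliceWinSchedules

/-! ## §1 The frozen step INSIDE the H2 step law: identity transport under a Dirac fluctuation law, at which (w2-act) holds [folklore] -/

section Frozen

variable {Z : Type*} [MeasurableSpace Z] {𝒰 : Type*} {F : Type*} [NormedAddCommGroup F] [NormedSpace ℂ F]

omit [NormedSpace ℂ F] in
/-- Two functions that agree `dirac a`-a.e. agree AT `a` — no measurability needed (`Measure.dirac_apply_of_mem`). [folklore] -/
theorem eq_at_of_ae_eq_dirac {E : Type*} {f g : Z → E} {a : Z} (h : f =ᵐ[Measure.dirac a] g) : f a = g a := by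
  by_contra hne
  have h1 : Measure.dirac a {x | f x ≠ g x} = 1 := Measure.dirac_apply_of_mem hne
  have h0 : Measure.dirac a {x | ¬ f x = g x} = 0 := ae_iff.mp h
  exact one_ne_zero (h1.symm.trans h0)

omit [NormedSpace ℂ F] in
/-- The Bochner integral against `dirac a` of an a.e.-strongly-measurable integrand is its value at `a` (`integral_dirac'` on the
strongly measurable modification + `eq_at_of_ae_eq_dirac`). [folklore] -/
theorem integral_dirac_of_aestronglyMeasurable [NormedSpace ℝ F] [CompleteSpace F] {f : Z → F} {a : Z}
    (hf : AEStronglyMeasurable f (Measure.dirac a)) : ∫ z, f z ∂(Measure.dirac a) = f a := by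
  rw [integral_congr_ae hf.ae_eq_mk, integral_dirac' _ _ hf.stronglyMeasurable_mk]
  exact (eq_at_of_ae_eq_dirac hf.ae_eq_mk).symm

/-- **IDENTITY TRANSPORT.**  Under a Dirac fluctuation law sitting at the junk point `a` the totalised normalised operation is evaluation
at `a`, for EVERY weight `ω` and every `dirac a`-a.e.-strongly-measurable integrand (on the good set `(ω_U a)⁻¹ • (ω_U a • h a) = h a`,
off it `h a` by definition).  The measurability premise is what the displayed class binder `h𝒢` supplies (`BddClass`). [folklore] -/
theorem wOp_dirac_of_aestronglyMeasurable [CompleteSpace F] (ω : 𝒰 → Z → ℂ) {a : Z} (U : 𝒰) {h : Z → F}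
    (hh : AEStronglyMeasurable h (Measure.dirac a)) : wOp ω (Measure.dirac a) a U h = h a := by
  by_cases hc : Integrable (ω U) (Measure.dirac a) ∧ (∫ z, ω U z ∂(Measure.dirac a)) ≠ 0
  · have hω : (∫ z, ω U z ∂(Measure.dirac a)) = ω U a := integral_dirac_of_aestronglyMeasurable hc.1.aestronglyMeasurable
    have hωh : (∫ z, ω U z • h z ∂(Measure.dirac a)) = ω U a • h a :=
      integral_dirac_of_aestronglyMeasurable (f := fun z => ω U z • h z) (hc.1.aestronglyMeasurable.smul hh)
    have hne : ω U a ≠ 0 := hω ▸ hc.2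
    rw [wOp_of_pos hc.1 hc.2, hω, hωh, smul_smul, inv_mul_cancel₀ hne, one_smul]
  · exact wOp_of_neg hc h

/-- The measurable-singletons one-liner (the cell's bond variables are Borel over a normed ring; `Fld d R` is a countable product).
[folklore] -/
theorem wOp_dirac [CompleteSpace F] [MeasurableSingletonClass Z] (ω : 𝒰 → Z → ℂ) (a : Z) (U : 𝒰) (h : Z → F) :
    wOp ω (Measure.dirac a) a U h = h a :=
  wOp_dirac_of_aestronglyMeasurable ω U ⟨fun _ => h a, stronglyMeasurable_const, ae_eq_dirac h⟩

/-- **THE H2 STEP LAW AT THE FROZEN DICTIONARY READS AS THE IDENTITY**: with `μ = dirac 0`, `z₀ = 0` (ANY `base`, `𝒜`, `𝒬`) the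
displayed step law `hFn` together with the displayed class binder `h𝒢` says `Fn′ = Fn`. [folklore] -/
theorem frozen_step_identity [CompleteSpace F] {V : Type*} [AddZeroClass V] [MeasurableSpace V] {Fn Fn' : V → F}
    {base : V → ℝ} {𝒜 𝒬 : V → V → ℂ}
    (hFn : ∀ U, Fn' U = wOp (expWeight base (𝒜 + 𝒬)) (Measure.dirac 0) 0 U (fun z => Fn (U + z)))
    (h𝒢 : ∀ U, (fun z => Fn (U + z)) ∈ BddClass F (Measure.dirac (0 : V))) : Fn' = Fn := by
  funext U
  rw [hFn U, wOp_dirac_of_aestronglyMeasurable _ U (h𝒢 U).1, add_zero]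

/-- **(w2-act)'s REAL REGULAR REFERENCE HOLDS AT THE FROZEN DICTIONARY**: base `1`, zero action exponent, Dirac law — mass `1 > 0`, real
(zero) exponent at every reference, integrable constant base density; any reference map, any window. [folklore] -/
theorem realBaseAt_frozen (ref : 𝒰 → 𝒰) (𝒦 : Set 𝒰) (a : Z) :
    RealBaseAt ref (fun _ : Z => (1 : ℝ)) (fun (_ : 𝒰) (_ : Z) => (0 : ℂ)) (Measure.dirac a) 𝒦 := by
  refine ⟨Filter.Eventually.of_forall fun _ => zero_le_one, ?_, fun U₀ _ => ⟨aestronglyMeasurable_const, ?_, ?_⟩⟩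
  · rw [Function.support_const one_ne_zero, measure_univ]
    exact zero_lt_one
  · exact Filter.Eventually.of_forall fun _ => by simp
  · have h : baseDensity (fun _ : Z => (1 : ℝ)) (fun (_ : 𝒰) (_ : Z) => (0 : ℂ)) (ref U₀) = fun _ => 1 := by
      funext z
      simp [baseDensity]
    rw [h]
    exact integrable_const _

/-- **(w2-act)'s EXPONENT SLICE HOLDS AT THE FROZEN DICTIONARY**: the zero exponent is measurable, holomorphic along every slice and
oscillates by `0 ≤ s` about every reference — any law, any move, any window (the owner's «identity step, s = 0»). [folklore] -/
theorem exponentSliceAt_frozen {Dir : Type*} (ref : 𝒰 → 𝒰) (μ : Measure Z) (move : 𝒰 → Dir → ℂ → 𝒰) (N : Dir → ℝ) (𝒦 : Set 𝒰)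
    (w ϱ : ℝ) {s : ℝ} (hs : 0 ≤ s) : ExponentSliceAt ref (fun (_ : 𝒰) (_ : Z) => (0 : ℂ)) μ move N 𝒦 w ϱ s := by
  intro U₀ _ dd _ _
  refine ⟨Set.univ, isOpen_univ, fun _ _ => Set.subset_univ _, fun _ _ => aestronglyMeasurable_const,
    Filter.Eventually.of_forall fun _ => differentiableOn_const _, Filter.Eventually.of_forall fun _ _ _ => ?_⟩
  simpa using hs

omit [NormedAddCommGroup F] [NormedSpace ℂ F] in
/-- Under a Dirac law with measurable singletons every function is a.e.-strongly measurable (`hmeas` is free at an idle step). [folklore] -/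
theorem aestronglyMeasurable_dirac [MeasurableSingletonClass Z] {E : Type*} [TopologicalSpace E] (h : Z → E) (a : Z) :
    AEStronglyMeasurable h (Measure.dirac a) :=
  ⟨fun _ => h a, stronglyMeasurable_const, ae_eq_dirac h⟩

omit [NormedSpace ℂ F] in
/-- … and every integrand is in the class `BddClass` (`h𝒢` is free at an idle step). [folklore] -/
theorem mem_bddClass_dirac [MeasurableSingletonClass Z] (h : Z → F) (a : Z) : h ∈ BddClass F (Measure.dirac a) :=
  ⟨aestronglyMeasurable_dirac h a, ‖h a‖, (ae_eq_dirac h).mono fun z hz => by simp [hz]⟩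

end Frozen

/-! ## §2 The tower-level binders, once — S3l.1's list with (w2-act) asked at spectator steps only -/

section EndAll

variable {P : Type*} (𝒯 : DressedTower P)
variable {R : Type*} [NormedRing R] [NormedAlgebra ℂ R] [MeasurableSpace R] {d : ℕ}
variable {κ L cbar N₀ A₀ sbar ρ' r cδ m : ℝ} {w : P → ℕ → ℝ}
variable (W : ∀ (a : P) (K : ℕ), WindowScheduleModWin r (w a K)) (hκ : 0 ≤ κ)
variable {Fn : ∀ (a : P) (K : ℕ), (𝒯.B a K).Birth → ℕ → ℕ → Fld d R → ℂ}
  {rel : ∀ (a : P) (K : ℕ), (𝒯.B a K).Birth → ℕ → ℕ → Fld d R → Fld d R → Prop}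
  {ref : ∀ (a : P) (K : ℕ), (𝒯.B a K).Birth → ℕ → Fld d R → Fld d R}
  {base : ∀ (a : P) (K : ℕ), (𝒯.B a K).Birth → ℕ → Fld d R → ℝ}
  {𝒜 𝒬 : ∀ (a : P) (K : ℕ), (𝒯.B a K).Birth → ℕ → Fld d R → Fld d R → ℂ}
  {q : ∀ (a : P) (K : ℕ), (𝒯.B a K).Birth → ℕ → Fld d R → ℂ}
  {μ : ∀ (a : P) (K : ℕ), (𝒯.B a K).Birth → ℕ → Measure (Fld d R)}
  {z₀ z₁ : ∀ (a : P) (K : ℕ), (𝒯.B a K).Birth → ℕ → Fld d R}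
  {defect : ∀ (a : P) (K : ℕ), (𝒯.B a K).Birth → ℕ → ℕ → ℝ}
  {s : ∀ (a : P) (K : ℕ), (𝒯.B a K).Birth → ℕ → ℝ}
  {S : ∀ (a : P) (K : ℕ), ℕ → (𝒯.B a K).Birth → Finset (𝒯.B a K).Birth}
  {Sg : ∀ (a : P) (K : ℕ), ℕ → (𝒯.B a K).Birth → Finset ((𝒯.B a K).Birth × ℕ)}
  {c : ∀ (a : P) (K : ℕ), (𝒯.B a K).Birth → ℕ → ℂ}
  {δf : ∀ (a : P) (K : ℕ), (𝒯.B a K).Birth → ℕ → (𝒯.B a K).Birth × ℕ → ℝ}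
  {creg : ∀ (_ : P) (_ : ℕ), ℕ → ℝ}
-- DATA replacing the structural leaves: anchoring + met-component housing (L-C), the ℝ-step (L-B) — S3l.1 verbatim
variable {Lb mB v vR : ℕ} (Anch : ∀ (a : P) (K : ℕ), Anchoring (𝒯.B a K) 4 Lb)
  {comp : ∀ (a : P) (K : ℕ), ℕ → (𝒯.B a K).Birth → Finset (𝒯.B a K).Cube}
  (Rs : ∀ (a : P) (K : ℕ), RStep (𝒯.B a K))
  {β : ∀ (_ : P) (_ : ℕ), ℕ → ℝ} {A β₀ : ℝ}

-- the ratio family (K-free κ)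
variable (hratio : ∀ (a : P) (K : ℕ), ∀ k, 2 * (W a K).σ k ≤ κ * (W a K).ϱc k)
-- row S3's located scalars ((w7) largeness, (w6) window) and signs — ONCE
variable (hL : 1 ≤ L)
variable (hcbar : 0 ≤ cbar)
variable (hN₀ : 0 ≤ N₀)
variable (hA₀ : 0 ≤ A₀)
variable (hm : 0 ≤ m)
variable (hloc : locCell L (4 * cδ / r) cbar κ ≤ ρ')
variable (hρ'1 : ρ' < 1)
variable (hsmall : m * (N₀ * A₀ * (1 - ρ')⁻¹) ≤ 1 - sbar)
variable (hr : 0 < r)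
variable (hcδ : 0 ≤ cδ)
-- the assembled END's estimate families (S3l.1 verbatim, except (w2-act): see `Spec` ∕ `hBspec` ∕ `hEspec` ∕ `hfrz` below)
variable (hsl : ∀ (a : P) (K : ℕ), ∀ (b : (𝒯.B a K).Birth) (k' : ℕ), (𝒯.B a K).birthScale b ≤ k' → k' ≤ (𝒯.B a K).K →
  RanBelow (budgetGate (𝒯.T a K) (s a K) m (S a K) (4 * cδ / r) (fun i => (L ^ 2)⁻¹ * (fun _ : ℕ => alphaCell κ) i)) k' →
  BirthSlice ((Fn a K) b k' k') latMove latN (bondBall d ((W a K).ρw k') : Set (Fld d R)) ((W a K).wc k') r ((𝒯.T a K).gen b k'))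
variable (hFn : ∀ (a : P) (K : ℕ), ∀ (b : (𝒯.B a K).Birth) (k' k : ℕ), (𝒯.B a K).birthScale b ≤ k' → k' ≤ k →
  k + 1 ≤ (𝒯.B a K).K →
  RanBelow (budgetGate (𝒯.T a K) (s a K) m (S a K) (4 * cδ / r) (fun i => (L ^ 2)⁻¹ * (fun _ : ℕ => alphaCell κ) i)) (k + 1) →
  ∀ U, (Fn a K) b k' (k + 1) U =
    wOp (expWeight ((base a K) b k) ((𝒜 a K) b k + (𝒬 a K) b k)) ((μ a K) b k) ((z₀ a K) b k) U (fun z => (Fn a K) b k' k (U + z)))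
variable (h𝒢 : ∀ (a : P) (K : ℕ), ∀ (b : (𝒯.B a K).Birth) (k' k : ℕ), (𝒯.B a K).birthScale b ≤ k' → k' ≤ k →
  k + 1 ≤ (𝒯.B a K).K →
  RanBelow (budgetGate (𝒯.T a K) (s a K) m (S a K) (4 * cδ / r) (fun i => (L ^ 2)⁻¹ * (fun _ : ℕ => alphaCell κ) i)) (k + 1) →
  ∀ U, (fun z => (Fn a K) b k' k (U + z)) ∈ BddClass ℂ ((μ a K) b k))
-- THE F-2-ROUTE CLASSIFICATION (DATA): `Spec a K b k` = «the step `k → k+1` of family `b` is a SPECTATOR (normalised `wOp`) step»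
variable (Spec : ∀ (a : P) (K : ℕ), (𝒯.B a K).Birth → ℕ → Prop)
-- (w2-act) AT SPECTATOR STEPS ONLY: S3l's `hB` ∕ `hE` (l.219–227 there) with the extra premise `Spec a K b k`
variable (hBspec : ∀ (a : P) (K : ℕ), ∀ (b : (𝒯.B a K).Birth) (k' k : ℕ), (𝒯.B a K).birthScale b ≤ k' → k' ≤ k →
  k + 1 ≤ (𝒯.B a K).K →
  RanBelow (budgetGate (𝒯.T a K) (s a K) m (S a K) (4 * cδ / r) (fun i => (L ^ 2)⁻¹ * (fun _ : ℕ => alphaCell κ) i)) (k + 1) →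
  Spec a K b k →
  RealBaseAt ((ref a K) b k) ((base a K) b k) ((𝒜 a K) b k) ((μ a K) b k) (bondBall d ((W a K).ρw (k + 1)) : Set (Fld d R)))
variable (hEspec : ∀ (a : P) (K : ℕ), ∀ (b : (𝒯.B a K).Birth) (k' k : ℕ), (𝒯.B a K).birthScale b ≤ k' → k' ≤ k →
  k + 1 ≤ (𝒯.B a K).K →
  RanBelow (budgetGate (𝒯.T a K) (s a K) m (S a K) (4 * cδ / r) (fun i => (L ^ 2)⁻¹ * (fun _ : ℕ => alphaCell κ) i)) (k + 1) →
  Spec a K b k →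
  ExponentSliceAt ((ref a K) b k) ((𝒜 a K) b k) ((μ a K) b k) latMove latN (bondBall d ((W a K).ρw (k + 1)) : Set (Fld d R))
    ((W a K).wc (k + 1)) ((W a K).ϱc k) ((s a K) b k))
-- the FROZEN ∕ ABSORBED dictionary `hfrz` («identity step, s = 0», §1) at `¬ Spec a K b k` sits in each theorem's HEADER below
variable (hδf : ∀ (a : P) (K : ℕ), ∀ b k, ∀ x ∈ (Sg a K) k b, 0 ≤ (δf a K) b k x ∧ (δf a K) b k x ≤ cδ * ((L ^ 2)⁻¹) ^ (k - x.2))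
variable (hDμ : ∀ (a : P) (K : ℕ), ∀ b k, ∀ᵐ z ∂(μ a K) b k, z ∈ (bondBall d ((W a K).σ k) : Set (Fld d R)))
variable (hz₁ : ∀ (a : P) (K : ℕ), ∀ b k, (z₁ a K) b k ∈ (bondBall d ((W a K).σ k) : Set (Fld d R)))
variable (hpairx : ∀ (a : P) (K : ℕ), ∀ (b : (𝒯.B a K).Birth) (k' k : ℕ), (𝒯.B a K).birthScale b ≤ k' → k' ≤ k →
  ∀ x ∈ (Sg a K) k b, ∀ U₀ ∈ (bondBall d ((W a K).ρw (k + 1)) : Set (Fld d R)), ∀ pd : NDir d R, 0 < latN pd →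
    latN pd ≤ (W a K).wc (k + 1) →
    ∀ᵐ z ∂(μ a K) b k, ∀ t ∈ tube ((W a K).ϱ₁ k / latN pd),
      RelGauge ((rel a K) x.1 x.2 k) latMove latN (latMove U₀ pd t + (z₁ a K) b k) (latMove U₀ pd t + z) ((δf a K) b k x))
variable (hinv : ∀ (a : P) (K : ℕ), ∀ b k' k, GaugeInvariant ((rel a K) b k' k) ((Fn a K) b k' k))
variable (hmeas : ∀ (a : P) (K : ℕ), ∀ (b f : (𝒯.B a K).Birth) (k'' k : ℕ) (U : Fld d R),
  AEStronglyMeasurable (fun z => (Fn a K) f k'' k (U + z)) ((μ a K) b k))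
variable (hdefwk : ∀ (a : P) (K : ℕ), ∀ (b : (𝒯.B a K).Birth) (k' k : ℕ), (defect a K) b k' k ≤ (W a K).wc k)
variable (hrate : ∀ (a : P) (K : ℕ), ∀ (b : (𝒯.B a K).Birth) (k' k : ℕ), (𝒯.B a K).birthScale b ≤ k' → k' ≤ k → k ≤ (𝒯.B a K).K →
  (defect a K) b k' k ≤ cδ * ((L ^ 2)⁻¹) ^ (k - k'))
-- F-8 REPLACED BY THE BOOKING CONVENTION (row S8): admissible pairs exist, booked size ≤ sup of realised increments
variable (hne : ∀ (a : P) (K : ℕ), ∀ (b : (𝒯.B a K).Birth) (k' k : ℕ), (𝒯.B a K).birthScale b ≤ k' → k' ≤ k → k ≤ (𝒯.B a K).K →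
  RanBelow (budgetGate (𝒯.T a K) (s a K) m (S a K) (4 * cδ / r) (fun i => (L ^ 2)⁻¹ * (fun _ : ℕ => alphaCell κ) i)) k →
  ∃ U₀ ∈ (bondBall d ((W a K).ρw k) : Set (Fld d R)), ∃ U₁ : Fld d R,
  RelGauge ((rel a K) b k' k) latMove latN U₀ U₁ ((defect a K) b k' k))
variable (hsup : ∀ (a : P) (K : ℕ), ∀ (b : (𝒯.B a K).Birth) (k' k : ℕ), (𝒯.B a K).birthScale b ≤ k' → k' ≤ k → k ≤ (𝒯.B a K).K →
  RanBelow (budgetGate (𝒯.T a K) (s a K) m (S a K) (4 * cδ / r) (fun i => (L ^ 2)⁻¹ * (fun _ : ℕ => alphaCell κ) i)) k →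
  (𝒯.T a K).lin b k' k ≤ sSup {x : ℝ | ∃ U₀ ∈ (bondBall d ((W a K).ρw k) : Set (Fld d R)), ∃ U₁ : Fld d R,
    RelGauge ((rel a K) b k' k) latMove latN U₀ U₁ ((defect a K) b k' k) ∧ x = ‖(Fn a K) b k' k U₁ - (Fn a K) b k' k U₀‖})
-- the booking-level wall binders: (w5) regeneration, (w2-act) margin
variable (hc0 : ∀ (a : P) (K : ℕ), ∀ k, 0 ≤ (creg a K) k)
variable (hcb : ∀ (a : P) (K : ℕ), ∀ k, k < (𝒯.B a K).K → (creg a K) k ≤ cbar)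
variable (hreg : ∀ (a : P) (K : ℕ), (𝒯.T a K).RegeneratesFromVar (creg a K)
  (budgetGate (𝒯.T a K) (s a K) m (S a K) (4 * cδ / r) (fun _ : ℕ => (L ^ 2)⁻¹ * alphaCell κ)))
variable (hs₀ : ∀ (a : P) (K : ℕ), ∀ b k, (s a K) b k ≤ sbar)
-- (w3-book) L-C REPLACED BY ANCHORING DATA (row S4): blocking integer, multiplicity, housing, component volume
variable (hLb : (Lb : ℝ) = L)
variable (hmult : ∀ (a : P) (K : ℕ), ∀ j (x : Fin 4 → ℕ),
  ((𝒯.B a K).births.filter fun b => (𝒯.B a K).birthScale b = j ∧ x ∈ (Anch a K).dom b).card ≤ mB)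
variable (hscale : ∀ (a : P) (K : ℕ), ∀ k b, ∀ q ∈ (comp a K) k b, (𝒯.B a K).cubeScale q = k)
variable (hhoused : ∀ (a : P) (K : ℕ), ∀ k b, ∀ f ∈ (S a K) k b, ∃ q ∈ (comp a K) k b, f ∈ (𝒯.B a K).feltAt q)
variable (hvol : ∀ (a : P) (K : ℕ), ∀ k b, ((comp a K) k b).card ≤ v)
-- (w1)+(w5b) L-B REPLACED BY THE ℝ-STEP SEAM (rows S5 §3 ∕ S5e, as in S3k.1): component volume, pre-ℝ sizes below the transported
-- envelope under the dressed history, the absorption law («budgets add»), dressing sizes; the fan-out pair sits in the theorem headers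
variable (hcv : ∀ (a : P) (K : ℕ), (Rs a K).CompVol vR)
variable (hpre : ∀ (a : P) (K : ℕ), (𝒯.T a K).PreBelowEnv (Rs a K) (4 * cδ / r) (fun _ : ℕ => (L ^ 2)⁻¹ * alphaCell κ)
  (budgetGate (𝒯.T a K) (s a K) m (S a K) (4 * cδ / r) (fun _ : ℕ => (L ^ 2)⁻¹ * alphaCell κ)))
variable (hlaw : ∀ (a : P) (K : ℕ), (𝒯.T a K).AbsorbLaw (Rs a K) (4 * cδ / r) (β a K) A)
variable (hβ : ∀ (a : P) (K : ℕ), ∀ j, j ≤ (𝒯.B a K).K → (β a K) j ≤ β₀ * (L⁻¹ ^ 3) ^ ((𝒯.B a K).K - j))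



include hBspec in
omit [NormedAlgebra ℂ R] in
/-- **S3l.1's `hB` REBUILT**: at a spectator step it is `hBspec`; at a frozen ∕ absorbed step it is `realBaseAt_frozen` after rewriting
the step data along `hfrz`. [folklore] -/
theorem realBaseAt_of_route
    (hfrz : ∀ (a : P) (K : ℕ) (b : (𝒯.B a K).Birth) (k : ℕ), ¬ Spec a K b k →
      (μ a K) b k = Measure.dirac 0 ∧ (base a K) b k = (fun _ => 1) ∧ (𝒜 a K) b k = (fun _ _ => 0) ∧ 0 ≤ (s a K) b k) :
    ∀ (a : P) (K : ℕ), ∀ (b : (𝒯.B a K).Birth) (k' k : ℕ), (𝒯.B a K).birthScale b ≤ k' → k' ≤ k → k + 1 ≤ (𝒯.B a K).K →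
      RanBelow (budgetGate (𝒯.T a K) (s a K) m (S a K) (4 * cδ / r) (fun i => (L ^ 2)⁻¹ * (fun _ : ℕ => alphaCell κ) i)) (k + 1) →
      RealBaseAt ((ref a K) b k) ((base a K) b k) ((𝒜 a K) b k) ((μ a K) b k)
        (bondBall d ((W a K).ρw (k + 1)) : Set (Fld d R)) := by
  intro a K b k' k h₁ h₂ h₃ h₄
  by_cases hsp : Spec a K b k
  · exact hBspec a K b k' k h₁ h₂ h₃ h₄ hsp
  · obtain ⟨hμ, hb, h𝒜, -⟩ := hfrz a K b k hsp
    rw [hμ, hb, h𝒜]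
    exact realBaseAt_frozen _ _ _

include hEspec in
/-- **S3l.1's `hE` REBUILT**: at a spectator step it is `hEspec`; at a frozen ∕ absorbed step it is `exponentSliceAt_frozen` (margin
`0 ≤ s a K b k` from `hfrz`). [folklore] -/
theorem exponentSliceAt_of_route
    (hfrz : ∀ (a : P) (K : ℕ) (b : (𝒯.B a K).Birth) (k : ℕ), ¬ Spec a K b k →
      (μ a K) b k = Measure.dirac 0 ∧ (base a K) b k = (fun _ => 1) ∧ (𝒜 a K) b k = (fun _ _ => 0) ∧ 0 ≤ (s a K) b k) :
    ∀ (a : P) (K : ℕ), ∀ (b : (𝒯.B a K).Birth) (k' k : ℕ), (𝒯.B a K).birthScale b ≤ k' → k' ≤ k → k + 1 ≤ (𝒯.B a K).K →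
      RanBelow (budgetGate (𝒯.T a K) (s a K) m (S a K) (4 * cδ / r) (fun i => (L ^ 2)⁻¹ * (fun _ : ℕ => alphaCell κ) i)) (k + 1) →
      ExponentSliceAt ((ref a K) b k) ((𝒜 a K) b k) ((μ a K) b k) latMove latN (bondBall d ((W a K).ρw (k + 1)) : Set (Fld d R))
        ((W a K).wc (k + 1)) ((W a K).ϱc k) ((s a K) b k) := by
  intro a K b k' k h₁ h₂ h₃ h₄
  by_cases hsp : Spec a K b k
  · exact hEspec a K b k' k h₁ h₂ h₃ h₄ hsp
  · obtain ⟨-, -, h𝒜, hs⟩ := hfrz a K b k hsp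
    rw [h𝒜]
    exact exponentSliceAt_frozen _ _ _ _ _ _ _ hs

-- S3l.1's THEOREM-HEADER binders VERBATIM, same order (H2 dictionary `hQ`∕`hSg`, slice-window ties `hcm`∕`hδfwk`, fan-out pair at `vR·mB`)
variable (hQ : ∀ (a : P) (K : ℕ), ∀ b k, (fun U z => (𝒬 a K) b k U z - (q a K) b k U) =
    fun U z => (c a K) b k * ∑ x ∈ (Sg a K) k b, ((Fn a K) x.1 x.2 k (U + z) - (Fn a K) x.1 x.2 k (U + (z₁ a K) b k)))
  (hSg : ∀ (a : P) (K : ℕ), ∀ k b, ∀ x ∈ (Sg a K) k b, x.1 ∈ (S a K) k b ∧ (𝒯.B a K).birthScale x.1 ≤ x.2 ∧ x.2 ≤ k)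
  (hcm : ∀ (a : P) (K : ℕ), ∀ b k, ‖(c a K) b k‖ ≤ m)
  (hδfwk : ∀ (a : P) (K : ℕ), ∀ b k, ∀ x ∈ (Sg a K) k b, (δf a K) b k x ≤ (W a K).wc k)
  (hvN₀ : (v : ℝ) * mB ≤ N₀) (hA : 0 ≤ A)
  (hfan : fanout A ((vR : ℝ) * mB) ρ' < 1) (hamp : absorbAmplitude β₀ A ((vR : ℝ) * mB) ρ' ≤ A₀)

include W hκ Anch Rs hratio hL hcbar hN₀ hA₀ hm hloc hρ'1 hsmall hr hcδ hsl hFn h𝒢 Spec hBspec hEspec hδf hDμ hz₁ hpairx hinv hmeas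
  hdefwk hrate hne hsup hc0 hcb hreg hs₀ hLb hmult hscale hhoused hvol hcv hpre hlaw hβ hQ hSg hcm hδfwk hvN₀ hA hfan hamp

/-! ## §3 The absorption-route face: the row root (With-form and literally), ROOT-B, and ROOT-C of record -/

/-- **THE ABSORPTION-ROUTE FACE — THE ROW ROOT WITH ITS CONSTANTS DISPLAYED** [bookkeeping]: S3l.1's
`dressedStabilityWith_of_canonicalRStepSliceWinSchedules` BY NAME with (w2-act)'s `hB` ∕ `hE` supplied by `realBaseAt_of_route` ∕
`exponentSliceAt_of_route` — ASKED AT SPECTATOR STEPS ONLY (`hBspec` ∕ `hEspec`), every other step carried frozen (`hfrz`, identity transport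
inside `hFn`, §1); absorbed masses through the ℝ-step seam of S3l.1 (S5e `hbirth_of_rstep_cell`).  SAME constants
`(A₀, rhoOne L⁻² (4c_δ∕r) c̄ κ, L⁻³)`.  NOT «NE1′ proved»; 0 binders instantiated on Bałaban's densities. [folklore] -/
theorem dressedStabilityWith_of_absorptionRouteSchedules
    (hfrz : ∀ (a : P) (K : ℕ) (b : (𝒯.B a K).Birth) (k : ℕ), ¬ Spec a K b k →
      (μ a K) b k = Measure.dirac 0 ∧ (base a K) b k = (fun _ => 1) ∧ (𝒜 a K) b k = (fun _ _ => 0) ∧ 0 ≤ (s a K) b k) :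
    DressedStabilityWith 𝒯 A₀ (rhoOne (L ^ 2)⁻¹ (4 * cδ / r) cbar κ) (L⁻¹ ^ 3) :=
  dressedStabilityWith_of_canonicalRStepSliceWinSchedules 𝒯 W hκ Anch Rs hratio hL hcbar hN₀ hA₀ hm hloc hρ'1 hsmall hr hcδ hsl hFn
    h𝒢 (realBaseAt_of_route 𝒯 W Spec hBspec hfrz) (exponentSliceAt_of_route 𝒯 W Spec hEspec hfrz) hδf hDμ hz₁ hpairx hinv hmeas
    hdefwk hrate hne hsup hc0 hcb hreg hs₀ hLb hmult hscale hhoused hvol hcv hpre hlaw hβ hQ hSg hcm hδfwk hvN₀ hA hfan hamp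

/-- **THE ABSORPTION-ROUTE FACE — THE ROW ROOT `DressedStability 𝒯` LITERALLY** [bookkeeping]: «NE1′'s (α′) face ⇐ EXACTLY the displayed
WALL binders ∀ (a,K) with (w2-act) AT SPECTATOR STEPS ONLY + the H2 dictionary + the classification `Spec` ∕ `hfrz` + anchoring ∕ ℝ-step ∕
booking-convention DATA + located largeness + ratio-bounded schedules»; NOT proved; nothing of Bałaban's instantiated. [folklore] -/
theorem dressedStability_of_absorptionRouteSchedules
    (hfrz : ∀ (a : P) (K : ℕ) (b : (𝒯.B a K).Birth) (k : ℕ), ¬ Spec a K b k →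
      (μ a K) b k = Measure.dirac 0 ∧ (base a K) b k = (fun _ => 1) ∧ (𝒜 a K) b k = (fun _ _ => 0) ∧ 0 ≤ (s a K) b k) :
    DressedStability 𝒯 :=
  ⟨_, _, _, dressedStabilityWith_of_absorptionRouteSchedules 𝒯 W hκ Anch Rs hratio hL hcbar hN₀ hA₀ hm hloc hρ'1 hsmall hr hcδ hsl hFn
    h𝒢 Spec hBspec hEspec hδf hDμ hz₁ hpairx hinv hmeas hdefwk hrate hne hsup hc0 hcb hreg hs₀ hLb hmult hscale hhoused hvol hcv hpre
    hlaw hβ hQ hSg hcm hδfwk hvN₀ hA hfan hamp hfrz⟩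

/-- **THE ABSORPTION-ROUTE FACE ⟹ ROOT-B `DressedBudget 𝒯 wt`** [bookkeeping]: with nonnegative cube weights bounded by `w̄` and the SAME
anchoring read as the bookings' positional count (`1 ≤ v`), S3l.1's `dressedBudget_of_canonicalRStepSliceWinSchedules` BY NAME with
(w2-act) at spectator steps only. [folklore] -/
theorem dressedBudget_of_absorptionRouteSchedules
    (hfrz : ∀ (a : P) (K : ℕ) (b : (𝒯.B a K).Birth) (k : ℕ), ¬ Spec a K b k →
      (μ a K) b k = Measure.dirac 0 ∧ (base a K) b k = (fun _ => 1) ∧ (𝒜 a K) b k = (fun _ _ => 0) ∧ 0 ≤ (s a K) b k)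
    {wt : P → ℕ → ℕ → ℝ} {wbar : ℝ} (hwbar : 0 ≤ wbar)
    (hw0 : ∀ a K, ∀ j ≤ K, 0 ≤ wt a K j) (hwb : ∀ a K, ∀ j ≤ K, wt a K j ≤ wbar) (hv : 1 ≤ v) :
    DressedBudget 𝒯 wt :=
  dressedBudget_of_canonicalRStepSliceWinSchedules 𝒯 W hκ Anch Rs hratio hL hcbar hN₀ hA₀ hm hloc hρ'1 hsmall hr hcδ hsl hFn h𝒢
    (realBaseAt_of_route 𝒯 W Spec hBspec hfrz) (exponentSliceAt_of_route 𝒯 W Spec hEspec hfrz) hδf hDμ hz₁ hpairx hinv hmeas hdefwk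
    hrate hne hsup hc0 hcb hreg hs₀ hLb hmult hscale hhoused hvol hcv hpre hlaw hβ hQ hSg hcm hδfwk hvN₀ hA hfan hamp hwbar hw0 hwb hv

/-- **THE ABSORPTION-ROUTE FACE ⟹ ROOT-C OF RECORD `DressedStabilityStrict 𝒯 (L ^ 4)`** [bookkeeping]: S3s-1's face-agnostic bridge
`dressedStabilityStrict_of_cellWith` (the strict product `L⁴·rhoOne·L⁻³ = locCell … ≤ ρ′ < 1`, Λ = L⁴ NAMED) applied to the With-form
above. [folklore] -/
theorem dressedStabilityStrict_of_absorptionRouteSchedules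
    (hfrz : ∀ (a : P) (K : ℕ) (b : (𝒯.B a K).Birth) (k : ℕ), ¬ Spec a K b k →
      (μ a K) b k = Measure.dirac 0 ∧ (base a K) b k = (fun _ => 1) ∧ (𝒜 a K) b k = (fun _ _ => 0) ∧ 0 ≤ (s a K) b k) :
    DressedStabilityStrict 𝒯 (L ^ 4) :=
  dressedStabilityStrict_of_cellWith hL hloc hρ'1
    (dressedStabilityWith_of_absorptionRouteSchedules 𝒯 W hκ Anch Rs hratio hL hcbar hN₀ hA₀ hm hloc hρ'1 hsmall hr hcδ hsl hFn h𝒢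
      Spec hBspec hEspec hδf hDμ hz₁ hpairx hinv hmeas hdefwk hrate hne hsup hc0 hcb hreg hs₀ hLb hmult hscale hhoused hvol hcv hpre
      hlaw hβ hQ hSg hcm hδfwk hvN₀ hA hfan hamp hfrz)

end EndAll

end Summit.QuantumFields.BalabanUV.T4Continuum.NE1p.DressedStabilityOfAbsorptionRouteSchedules

end
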